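import Mathlib
import Summits.Ventures.PercRepro2.Defs
import Summits.Ventures.PercRepro2.Independence
import Summits.Ventures.PercRepro2.Harris
import Summits.Ventures.PercRepro2.ZCTwoEdge

/-!
# Theorem E (MINE-A.md §70.7) — the five-type split of `G − a₃`
(blind cell PercRepro2, mine-a g24)

Bookkeeping for `ZCA3W.lean`: for events `A`, `W`, `Γ` of a configuration space (in the graph
instance `A = {a₁ ↔ o}`, `W = {a₁ ↔ w}`, `Γ = {w ↔ o}` in `G − a₃`) the five TYPES are
`T₁ = A ∩ W`, `T₂ = A ∩ Wᶜ`, `T₃ = Aᶜ ∩ W`, `T₄ = Aᶜ ∩ Wᶜ ∩ Γ`, `T₅ = Aᶜ ∩ Wᶜ ∩ Γᶜ` (a partition of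
the configuration space).  `prob_eq_sum_five` splits any probability along the types, and the
lemmas `prob_inter_*` express `P(Y ∩ S)` for the events `S ∈ {A ∪ Γ, (A ∪ Γ)ᶜ, A, Aᶜ, W, A ∪ W, Γ}`
and the mixed cell `(W ∩ X₁) ∪ (Wᶜ ∩ X₀)` through the type masses `P(Y ∩ Tτ)`, using the
transitivity relations `W ∩ Γ ⊆ A`, `A ∩ W ⊆ Γ`, `A ∩ Γ ⊆ W` where needed.  One seat.
-/

namespace Summit.Ventures.PercRepro2

section TypeSplit

variable {E : Type*} [Fintype E] [DecidableEq E] {R : Type*} [CommRing R]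

/-- Splitting a probability along the five types built from `A`, `W`, `Γ`. -/
lemma prob_eq_sum_five (p : E → R) (A W Γ Y : Set (Config E)) :
    prob p Y = prob p (Y ∩ (A ∩ W)) + prob p (Y ∩ (A ∩ Wᶜ)) + prob p (Y ∩ (Aᶜ ∩ W))
      + prob p (Y ∩ (Aᶜ ∩ Wᶜ ∩ Γ)) + prob p (Y ∩ (Aᶜ ∩ Wᶜ ∩ Γᶜ)) := by
  have h1 := prob_inter_add_prob_inter_compl p Y A
  have h2 := prob_inter_add_prob_inter_compl p (Y ∩ A) W
  have h3 := prob_inter_add_prob_inter_compl p (Y ∩ Aᶜ) W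
  have h4 := prob_inter_add_prob_inter_compl p (Y ∩ Aᶜ ∩ Wᶜ) Γ
  rw [Set.inter_assoc, Set.inter_assoc] at h2 h3
  have e4 : Y ∩ Aᶜ ∩ Wᶜ ∩ Γ = Y ∩ (Aᶜ ∩ Wᶜ ∩ Γ) := by
    simp only [Set.inter_assoc]
  have e5 : Y ∩ Aᶜ ∩ Wᶜ ∩ Γᶜ = Y ∩ (Aᶜ ∩ Wᶜ ∩ Γᶜ) := by
    simp only [Set.inter_assoc]
  have e45 : Y ∩ Aᶜ ∩ Wᶜ = Y ∩ (Aᶜ ∩ Wᶜ) := by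
    simp only [Set.inter_assoc]
  rw [e4, e5, e45] at h4
  linear_combination -h1 - h2 - h3 - h4

variable (p : E → R) {A W Γ : Set (Config E)}

/-- `P(Y ∩ (A ∪ Γ))` in type masses, when `W ∩ Γ ⊆ A`. -/
lemma prob_inter_union_AΓ (hWΓ : ∀ ω, ω ∈ W → ω ∈ Γ → ω ∈ A) (Y : Set (Config E)) :
    prob p (Y ∩ (A ∪ Γ)) = prob p (Y ∩ (A ∩ W)) + prob p (Y ∩ (A ∩ Wᶜ)) + prob p (Y ∩ (Aᶜ ∩ Wᶜ ∩ Γ)) := by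
  rw [prob_eq_sum_five p A W Γ (Y ∩ (A ∪ Γ))]
  have e1 : Y ∩ (A ∪ Γ) ∩ (A ∩ W) = Y ∩ (A ∩ W) := by
    ext ω; simp only [Set.mem_inter_iff, Set.mem_union]; tauto
  have e2 : Y ∩ (A ∪ Γ) ∩ (A ∩ Wᶜ) = Y ∩ (A ∩ Wᶜ) := by
    ext ω; simp only [Set.mem_inter_iff, Set.mem_union, Set.mem_compl_iff]; tauto
  have e3 : Y ∩ (A ∪ Γ) ∩ (Aᶜ ∩ W) = ∅ := by
    ext ω; have := hWΓ ω
    simp only [Set.mem_inter_iff, Set.mem_union, Set.mem_compl_iff, Set.mem_empty_iff_false]; tauto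
  have e4 : Y ∩ (A ∪ Γ) ∩ (Aᶜ ∩ Wᶜ ∩ Γ) = Y ∩ (Aᶜ ∩ Wᶜ ∩ Γ) := by
    ext ω; simp only [Set.mem_inter_iff, Set.mem_union, Set.mem_compl_iff]; tauto
  have e5 : Y ∩ (A ∪ Γ) ∩ (Aᶜ ∩ Wᶜ ∩ Γᶜ) = ∅ := by
    ext ω; simp only [Set.mem_inter_iff, Set.mem_union, Set.mem_compl_iff, Set.mem_empty_iff_false]; tauto
  rw [e1, e2, e3, e4, e5, prob_empty]; ring

/-- `P(Y ∩ (A ∪ Γ)ᶜ)` in type masses, when `W ∩ Γ ⊆ A`. -/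
lemma prob_inter_compl_union_AΓ (hWΓ : ∀ ω, ω ∈ W → ω ∈ Γ → ω ∈ A) (Y : Set (Config E)) :
    prob p (Y ∩ (A ∪ Γ)ᶜ) = prob p (Y ∩ (Aᶜ ∩ W)) + prob p (Y ∩ (Aᶜ ∩ Wᶜ ∩ Γᶜ)) := by
  rw [prob_eq_sum_five p A W Γ (Y ∩ (A ∪ Γ)ᶜ)]
  have e1 : Y ∩ (A ∪ Γ)ᶜ ∩ (A ∩ W) = ∅ := by
    ext ω; simp only [Set.mem_inter_iff, Set.mem_union, Set.mem_compl_iff, Set.mem_empty_iff_false]; tauto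
  have e2 : Y ∩ (A ∪ Γ)ᶜ ∩ (A ∩ Wᶜ) = ∅ := by
    ext ω; simp only [Set.mem_inter_iff, Set.mem_union, Set.mem_compl_iff, Set.mem_empty_iff_false]; tauto
  have e3 : Y ∩ (A ∪ Γ)ᶜ ∩ (Aᶜ ∩ W) = Y ∩ (Aᶜ ∩ W) := by
    ext ω; have := hWΓ ω
    simp only [Set.mem_inter_iff, Set.mem_union, Set.mem_compl_iff]; tauto
  have e4 : Y ∩ (A ∪ Γ)ᶜ ∩ (Aᶜ ∩ Wᶜ ∩ Γ) = ∅ := by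
    ext ω; simp only [Set.mem_inter_iff, Set.mem_union, Set.mem_compl_iff, Set.mem_empty_iff_false]; tauto
  have e5 : Y ∩ (A ∪ Γ)ᶜ ∩ (Aᶜ ∩ Wᶜ ∩ Γᶜ) = Y ∩ (Aᶜ ∩ Wᶜ ∩ Γᶜ) := by
    ext ω; simp only [Set.mem_inter_iff, Set.mem_union, Set.mem_compl_iff]; tauto
  rw [e1, e2, e3, e4, e5, prob_empty]; ring

/-- `P(Y ∩ A)` in type masses. -/
lemma prob_inter_A (Y : Set (Config E)) :
    prob p (Y ∩ A) = prob p (Y ∩ (A ∩ W)) + prob p (Y ∩ (A ∩ Wᶜ)) := by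
  have := prob_inter_add_prob_inter_compl p (Y ∩ A) W
  rw [Set.inter_assoc, Set.inter_assoc] at this
  exact this.symm

/-- `P(Y ∩ Aᶜ)` in type masses. -/
lemma prob_inter_Ac (Y : Set (Config E)) :
    prob p (Y ∩ Aᶜ) = prob p (Y ∩ (Aᶜ ∩ W)) + prob p (Y ∩ (Aᶜ ∩ Wᶜ ∩ Γ)) + prob p (Y ∩ (Aᶜ ∩ Wᶜ ∩ Γᶜ)) := by
  have h := prob_eq_sum_five p A W Γ Y
  have h' := prob_inter_A p (A := A) (W := W) Y
  have := prob_inter_add_prob_inter_compl p Y A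
  linear_combination this - h' + h

/-- `P(Y ∩ W)` in type masses. -/
lemma prob_inter_W (Y : Set (Config E)) :
    prob p (Y ∩ W) = prob p (Y ∩ (A ∩ W)) + prob p (Y ∩ (Aᶜ ∩ W)) := by
  have := prob_inter_add_prob_inter_compl p (Y ∩ W) A
  have e1 : Y ∩ W ∩ A = Y ∩ (A ∩ W) := by ext ω; simp only [Set.mem_inter_iff]; tauto
  have e2 : Y ∩ W ∩ Aᶜ = Y ∩ (Aᶜ ∩ W) := by ext ω; simp only [Set.mem_inter_iff, Set.mem_compl_iff]; tauto
  rw [e1, e2] at this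
  exact this.symm

/-- `P(Y ∩ (A ∪ W))` in type masses. -/
lemma prob_inter_union_AW (Y : Set (Config E)) :
    prob p (Y ∩ (A ∪ W)) = prob p (Y ∩ (A ∩ W)) + prob p (Y ∩ (A ∩ Wᶜ)) + prob p (Y ∩ (Aᶜ ∩ W)) := by
  have := prob_inter_add_prob_inter_compl p (Y ∩ (A ∪ W)) A
  have e1 : Y ∩ (A ∪ W) ∩ A = Y ∩ A := by ext ω; simp only [Set.mem_inter_iff, Set.mem_union]; tauto
  have e2 : Y ∩ (A ∪ W) ∩ Aᶜ = Y ∩ (Aᶜ ∩ W) := by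
    ext ω; simp only [Set.mem_inter_iff, Set.mem_union, Set.mem_compl_iff]; tauto
  rw [e1, e2, prob_inter_A p (A := A) (W := W) Y] at this
  exact this.symm

/-- `P(Y ∩ Γ)` in type masses, when `W ∩ Γ ⊆ A`. -/
lemma prob_inter_Γ (hWΓ : ∀ ω, ω ∈ W → ω ∈ Γ → ω ∈ A) (hAW : ∀ ω, ω ∈ A → ω ∈ W → ω ∈ Γ)
    (hAΓ : ∀ ω, ω ∈ A → ω ∈ Γ → ω ∈ W) (Y : Set (Config E)) :
    prob p (Y ∩ Γ) = prob p (Y ∩ (A ∩ W)) + prob p (Y ∩ (Aᶜ ∩ Wᶜ ∩ Γ)) := by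
  rw [prob_eq_sum_five p A W Γ (Y ∩ Γ)]
  have e1 : Y ∩ Γ ∩ (A ∩ W) = Y ∩ (A ∩ W) := by
    ext ω; have := hAW ω; simp only [Set.mem_inter_iff]; tauto
  have e2 : Y ∩ Γ ∩ (A ∩ Wᶜ) = ∅ := by
    ext ω; have := hAΓ ω; simp only [Set.mem_inter_iff, Set.mem_compl_iff, Set.mem_empty_iff_false]; tauto
  have e3 : Y ∩ Γ ∩ (Aᶜ ∩ W) = ∅ := by
    ext ω; have := hWΓ ω; simp only [Set.mem_inter_iff, Set.mem_compl_iff, Set.mem_empty_iff_false]; tauto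
  have e4 : Y ∩ Γ ∩ (Aᶜ ∩ Wᶜ ∩ Γ) = Y ∩ (Aᶜ ∩ Wᶜ ∩ Γ) := by
    ext ω; simp only [Set.mem_inter_iff, Set.mem_compl_iff]; tauto
  have e5 : Y ∩ Γ ∩ (Aᶜ ∩ Wᶜ ∩ Γᶜ) = ∅ := by
    ext ω; simp only [Set.mem_inter_iff, Set.mem_compl_iff, Set.mem_empty_iff_false]; tauto
  rw [e1, e2, e3, e4, e5, prob_empty]; ring

/-- The mixed cell `(f₁ closed, f₂ open)`: `P((W ∩ X₁) ∪ (Wᶜ ∩ X₀))` in type masses. -/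
lemma prob_mix (X₀ X₁ : Set (Config E)) :
    prob p ((W ∩ X₁) ∪ (Wᶜ ∩ X₀)) = prob p (X₁ ∩ (A ∩ W)) + prob p (X₀ ∩ (A ∩ Wᶜ)) + prob p (X₁ ∩ (Aᶜ ∩ W))
      + prob p (X₀ ∩ (Aᶜ ∩ Wᶜ ∩ Γ)) + prob p (X₀ ∩ (Aᶜ ∩ Wᶜ ∩ Γᶜ)) := by
  rw [prob_eq_sum_five p A W Γ ((W ∩ X₁) ∪ (Wᶜ ∩ X₀))]
  have e1 : (W ∩ X₁ ∪ Wᶜ ∩ X₀) ∩ (A ∩ W) = X₁ ∩ (A ∩ W) := by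
    ext ω; simp only [Set.mem_inter_iff, Set.mem_union, Set.mem_compl_iff]; tauto
  have e2 : (W ∩ X₁ ∪ Wᶜ ∩ X₀) ∩ (A ∩ Wᶜ) = X₀ ∩ (A ∩ Wᶜ) := by
    ext ω; simp only [Set.mem_inter_iff, Set.mem_union, Set.mem_compl_iff]; tauto
  have e3 : (W ∩ X₁ ∪ Wᶜ ∩ X₀) ∩ (Aᶜ ∩ W) = X₁ ∩ (Aᶜ ∩ W) := by
    ext ω; simp only [Set.mem_inter_iff, Set.mem_union, Set.mem_compl_iff]; tauto
  have e4 : (W ∩ X₁ ∪ Wᶜ ∩ X₀) ∩ (Aᶜ ∩ Wᶜ ∩ Γ) = X₀ ∩ (Aᶜ ∩ Wᶜ ∩ Γ) := by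
    ext ω; simp only [Set.mem_inter_iff, Set.mem_union, Set.mem_compl_iff]; tauto
  have e5 : (W ∩ X₁ ∪ Wᶜ ∩ X₀) ∩ (Aᶜ ∩ Wᶜ ∩ Γᶜ) = X₀ ∩ (Aᶜ ∩ Wᶜ ∩ Γᶜ) := by
    ext ω; simp only [Set.mem_inter_iff, Set.mem_union, Set.mem_compl_iff]; tauto
  rw [e1, e2, e3, e4, e5]

end TypeSplit

end Summit.Ventures.PercRepro2
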